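import Summits.CriticalPhenomena.Ising3DConformalLimit.Theorems.EnergyNotSigmaSquaredMoebiusLimitExistsOrbitLiouvilleDefs
import Summits.CriticalPhenomena.Ising3DConformalLimit.Theorems.EnergyNotSigmaSquaredMoebiusLimitExistsOneMapOneJetJetReduction
import HarnessLib

/-!
# Line `Sketch` (§1, card `complex-circle-rotation-liouville`) for crux `MoebiusLimitExists`
(stmt-CriticalPhenomena-1344) — stub S3b: from the inversion law on good configurations to
`IsInversionCovariant` (`stub_inversion_of_orbitGood`)

For a family `S : CorrFamily 3` normalised off `NonCoincident`, continuous on it and symmetric under the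
free sign flip `R₃ = flipThree` on `NonCoincident`: if the inversion law holds on the good configurations
in the form delivered by the orbit argument (stub S3a),
`S n (ι R₃ x) = ∏ ‖xᵢ‖^{2Δ} · S n x` for every `x ∈ OrbitGood n` (`ι = EuclideanGeometry.inversion 0 1`
the unit inversion), then `S` is inversion covariant with weight `Δ` in the sense of the tree predicate
`IsInversionCovariant Δ S` (the law at EVERY configuration avoiding the pole `0`).

Proof. (1) `ι` commutes with the linear isometry `R₃` (`inversion_flipThree_comm'`), and `R₃` is a
symmetry of `S` at the non-coincident configuration `ι x`, so on `OrbitGood n` the hypothesis says exactly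
that the inversion defect `D_n = inversionDefect Δ S n` of the line `one-map-one-jet` vanishes
(`inversionDefect_eq_zero_of_mem_orbitGood`). (2) A configuration off the pole which is COINCIDENT has
`D_n x = 0` by normalisation (`inversionDefect_eq_zero_of_not_mem_nonCoincident`, `ι` preserves
non-coincidence). (3) A punctured non-coincident configuration is the limit as `t → 0⁺` of the good
configurations `x + t e₀` (injective for every `t`, and every point has first coordinate `xᵢ₀ + t ≠ 0`
for all small `t > 0`), `mem_closure_orbitGood`; `D_n` is continuous there
(`continuousAt_inversionDefect`), hence vanishes (`inversionDefect_eq_zero_of_mem_closure_orbitGood`).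
Finally `IsInversionCovariant Δ S` IS `D_n = 0` off the pole (`isInversionCovariant_iff_inversionDefect`).

References: Möbius covariance under the unit inversion, Di Francesco–Mathieu–Sénéchal 1997 §4.1
eq. (4.15), §4.3.1 eq. (4.62) (tree `Literature.Probability.LatticeModels.ConformalCovariance`); the
density/continuity step is folklore.
-/

noncomputable section

open Set Function Filter EuclideanGeometry
open scoped Topology
open Literature.Probability.LatticeModels
open Summit.CriticalPhenomena.Ising3DConformalLimit.MoebiusLimitExistsOneMapOneJet

namespace Summit.CriticalPhenomena.Ising3DConformalLimit.MoebiusLimitExistsOrbitLiouville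

/-! ### The inversion defect vanishes on good configurations -/

/-- The unit inversion commutes with the linear isometry `R₃` (both are built from `p` and `‖p‖`, and
`R₃` is linear and norm preserving): `ι (R₃ p) = R₃ (ι p)`. [folklore] -/
theorem inversion_flipThree_comm' (p : EuclideanSpace ℝ (Fin 3)) :
    inversion (0 : EuclideanSpace ℝ (Fin 3)) 1 (flipThree p) = flipThree (inversion 0 1 p) := by
  rw [inversion_zero_one_eq_smul, inversion_zero_one_eq_smul, LinearIsometryEquiv.norm_map,
    LinearIsometryEquiv.map_smul]

/-- On a good configuration `x` the orbit form of the inversion law, `S n (ι R₃ x) = ∏ ‖xᵢ‖^{2Δ} S n x`,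
together with the flip symmetry of `S` at the non-coincident configuration `ι x` gives
`S n (ι x) = ∏ ‖xᵢ‖^{2Δ} S n x`, i.e. the inversion defect vanishes at `x`. [folklore] -/
theorem inversionDefect_eq_zero_of_mem_orbitGood (Δ : ℝ) (S : CorrFamily 3)
    (hflip : ∀ n (x : Fin n → EuclideanSpace ℝ (Fin 3)), x ∈ NonCoincident 3 n →
      S n (fun i => flipThree (x i)) = S n x)
    (hgood : ∀ n (x : Fin n → EuclideanSpace ℝ (Fin 3)), x ∈ OrbitGood n →
      S n (fun i => inversion 0 1 (flipThree (x i))) = (∏ i, ‖x i‖ ^ (2 * Δ)) * S n x)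
    {n : ℕ} {x : Fin n → EuclideanSpace ℝ (Fin 3)} (hx : x ∈ OrbitGood n) :
    inversionDefect Δ S n x = 0 := by
  have hι : invCfg x ∈ NonCoincident 3 n := (invCfg_mem_nonCoincident_iff x).2 hx.1
  have h1 := hgood n x hx
  have hcfg : (fun i => inversion 0 1 (flipThree (x i))) = fun i => flipThree (invCfg x i) := by
    funext i
    rw [inversion_flipThree_comm', invCfg_apply]
  rw [hcfg, hflip n (invCfg x) hι] at h1
  rw [inversionDefect, h1, sub_self]

/-! ### Density of the good configurations and continuity of the defect -/

/-- Every non-coincident configuration is a limit of good configurations: the translates `x + t e₀`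
(`e₀` the first coordinate vector) are injective for every `t` and, for all small `t > 0`, every point
has non-zero first coordinate `xᵢ₀ + t`. [folklore] -/
theorem mem_closure_orbitGood {n : ℕ} {x : Fin n → EuclideanSpace ℝ (Fin 3)}
    (hx : x ∈ NonCoincident 3 n) : x ∈ closure (OrbitGood n) := by
  have hcont : Continuous fun t : ℝ => fun i => x i + t • EuclideanSpace.single (0 : Fin 3) (1 : ℝ) :=
    continuous_pi fun i => continuous_const.add (continuous_id.smul continuous_const)
  have hlim : Tendsto (fun t : ℝ => fun i => x i + t • EuclideanSpace.single (0 : Fin 3) (1 : ℝ))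
      (𝓝[>] 0) (𝓝 x) := by
    refine (hcont.tendsto' 0 x ?_).mono_left nhdsWithin_le_nhds
    funext i
    rw [zero_smul, add_zero]
  have hcoord : ∀ᶠ t in 𝓝[>] (0 : ℝ), ∀ i, x i 0 + t ≠ 0 := by
    refine eventually_all.2 fun i => ?_
    by_cases h0 : x i 0 = 0
    · filter_upwards [self_mem_nhdsWithin] with t ht
      rw [h0, zero_add]
      exact ne_of_gt ht
    · have hc : ContinuousAt (fun t : ℝ => x i 0 + t) 0 :=
        (continuous_const.add continuous_id).continuousAt
      exact eventually_nhdsWithin_of_eventually_nhds (hc.eventually_ne (by rwa [add_zero]))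
  have hmem : ∀ᶠ t in 𝓝[>] (0 : ℝ),
      (fun i => x i + t • EuclideanSpace.single (0 : Fin 3) (1 : ℝ)) ∈ OrbitGood n := by
    filter_upwards [hcoord] with t ht
    refine ⟨(add_left_injective _).comp ((mem_nonCoincident x).1 hx), fun i => Or.inl ?_⟩
    rw [PiLp.add_apply, PiLp.smul_apply, PiLp.single_apply, if_pos rfl, smul_eq_mul, mul_one]
    exact ht i
  exact mem_closure_of_tendsto hlim hmem

/-- At a punctured non-coincident configuration in the closure of the good set, a continuous inversion
defect vanishing on the good set vanishes (pattern of
`MoebiusLimitExistsOneMapOneJet.inversionDefect_eq_zero_of_mem_closure`). [folklore] -/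
theorem inversionDefect_eq_zero_of_mem_closure_orbitGood (Δ : ℝ) (S : CorrFamily 3) {n : ℕ}
    (hcont : ContinuousOn (S n) (NonCoincident 3 n))
    (hzero : ∀ y ∈ OrbitGood n, inversionDefect Δ S n y = 0)
    {x : Fin n → EuclideanSpace ℝ (Fin 3)} (hx : x ∈ PuncturedNonCoincident n)
    (hcl : x ∈ closure (OrbitGood n)) :
    inversionDefect Δ S n x = 0 := by
  have hcw : ContinuousWithinAt (inversionDefect Δ S n) (OrbitGood n) x :=
    (continuousAt_inversionDefect Δ S hcont hx).continuousWithinAt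
  have hmaps : MapsTo (inversionDefect Δ S n) (OrbitGood n) {0} :=
    fun y hy => mem_singleton_iff.2 (hzero y hy)
  have hmem := hcw.mem_closure hcl hmaps
  rwa [closure_singleton, mem_singleton_iff] at hmem

/-! ### The stub -/

/-- **Stub S3b — from the inversion law on good configurations to `IsInversionCovariant`.** `ι`
commutes with the linear isometry `R₃` and `R₃` is a symmetry of `S` on `NonCoincident`, so the law reads
`S n (ι x) = ∏ ‖xᵢ‖^{2Δ} S n x` on `OrbitGood n` (`inversionDefect_eq_zero_of_mem_orbitGood`);
configurations with all `xᵢ ≠ 0` that are not injective have both sides `0` (normalisation; `ι` is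
injective off the pole, `inversionDefect_eq_zero_of_not_mem_nonCoincident`), and injective ones are limits
of the good configurations `x + t e₀` (`t → 0⁺`, `mem_closure_orbitGood`), along which the defect is
continuous (`continuousAt_inversionDefect`), so it vanishes there too
(`inversionDefect_eq_zero_of_mem_closure_orbitGood`); and `IsInversionCovariant Δ S` IS the vanishing of
the defect off the pole (`isInversionCovariant_iff_inversionDefect`). [folklore] -/
theorem stub_inversion_of_orbitGood :
    ∀ (Δ : ℝ) (S : CorrFamily 3),
      (∀ n z, z ∉ NonCoincident 3 n → S n z = 0) →
      (∀ n, ContinuousOn (S n) (NonCoincident 3 n)) →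
      (∀ n (x : Fin n → EuclideanSpace ℝ (Fin 3)), x ∈ NonCoincident 3 n →
        S n (fun i => flipThree (x i)) = S n x) →
      (∀ n (x : Fin n → EuclideanSpace ℝ (Fin 3)), x ∈ OrbitGood n →
        S n (fun i => EuclideanGeometry.inversion 0 1 (flipThree (x i))) = (∏ i, ‖x i‖ ^ (2 * Δ)) * S n x) →
      IsInversionCovariant Δ S := by
  intro Δ S hnorm hcont hflip hgood
  rw [isInversionCovariant_iff_inversionDefect]
  intro n x hx
  by_cases hnc : x ∈ NonCoincident 3 n
  · exact inversionDefect_eq_zero_of_mem_closure_orbitGood Δ S (hcont n)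
      (fun y hy => inversionDefect_eq_zero_of_mem_orbitGood Δ S hflip hgood hy)
      ⟨hnc, hx⟩ (mem_closure_orbitGood hnc)
  · exact inversionDefect_eq_zero_of_not_mem_nonCoincident Δ S (hnorm n) hnc

end Summit.CriticalPhenomena.Ising3DConformalLimit.MoebiusLimitExistsOrbitLiouville

end
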